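import Literature.NumberTheory.ComplexMultiplication.ShimuraTaniyamaHecke
import Literature.NumberTheory.ComplexMultiplication.ComplexReflexField
import Literature.NumberTheory.ComplexMultiplication.ReflexCMType
import Literature.NumberTheory.ComplexMultiplication.InducedCMType
import Literature.AlgebraicGeometry.Motives.ZarhinHodgeGroupAutC
import Literature.FieldTheory.AlgClosed.AutFixedSubfield
import HarnessLib

/-!
# The reflex type ON `K` of the induced reflex type `Ψ̃` is `Φ` again; the reflex field of `Ψ̃` lies in `K`

Shimura, *Abelian Varieties with Complex Multiplication and Modular Functions* (1998), §8.3 (Prop. 28 and the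
paragraph after it: «the reflex of `(K*, Φ*)` … `K** ⊂ K`», the duality `S*(Φ*) = S(Φ)`), §18.5, §19.7 and Prop. 19.10
(19.10a)/(19.10c): the ∞-type of the character `χ_τ` of a structure of type `(K, Φ)` over `k ⊇ K*` is the reflex type of
`Φ` ON `k` seen from `τ` — the tree's `reflexTypeOn Φ τ σ₀` (`ShimuraTaniyamaHecke`); Streng 2010 Ch. I Lemma 7.2.

THIS FILE (theorems only; no definition, no named fact) computes `reflexTypeOn` in the situation of [Liu 2021] Def. 4.3 /
Def. 4.5 and [Shimura1998] Thm. 21.4 applied at the INDUCED type: `E` a CM field with complex CM type `Φ`, presented in a CM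
field `L` Galois over `ℚ` through `φ : E → L`, `ι : L → ℂ`; `K* = reflexField ℚ L Φ_L ⊆ L` the reflex field with its
complex reflex type `Ψ = reflexCMType ι Φ φ`; `M` ANY field receiving `K*` through `e` and embedded in `ℂ` by `τ₀` with
`τ₀ ∘ e = ι|_{K*}` (for Liu: `M = M_μ ⊇ M'_μ = ι(K*)`, `e = Def45.incl`, `τ₀` the inclusion `M_μ ⊆ ℂ`); `Ψ̃ = inducedCMType e Ψ`
the CM type of `M` induced from `Ψ`.

* **`reflexTypeOn_inducedCMType_reflexCMType`** — `reflexTypeOn Ψ̃ τ₀ (ι ∘ φ) = Φ`: an embedding `σ' = g ∘ ι ∘ φ` of `E`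
  (`g ∈ Aut ℂ`) has `g⁻¹ ∘ τ₀ ∈ Ψ̃` iff `g⁻¹ ∘ ι|_{K*} ∈ Ψ` iff (writing `g⁻¹ ∘ ι = ι ∘ h`, `h ∈ Gal(L/ℚ)`) `h ∈ S*(Φ_L, φ)`
  (`typeLift_reflexType`: `S(Φ*, ι*) = S*`) iff `ι ∘ h⁻¹ ∘ φ = σ' ∈ Φ`; and every `σ' ∈ Φ` is of this form (`Aut ℂ` is
  transitive on `Hom(L, ℂ)`, `Motives.ZarhinLie.exists_ringEquiv_complex_comp_eq`).  This is the identity behind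
  (19.10a) for the character `χ = χ_ε` of a structure of type `(M, Ψ̃)` over `E`: its ∞-type `cmInfinityType Ψ̃ τ₀ (ι ∘ φ)`
  IS the type `Φ` (`cmInfinityType_inducedCMType_reflexCMType`).
* **`cmTypeTrace_inducedCMType_reflexCMType_mem_range`**, **`traceField_inducedCMType_reflexCMType_subset_range`** —
  «`K** ⊂ K`» for the induced type: every type trace `∑_{θ ∈ Ψ̃} θ(x)` lies in `ι(φ(E))`, hence the reflex field
  `ℚ(tr_Ψ̃(M)) ⊆ ℂ` of `(M, Ψ̃)` (tree `traceField`) is contained in `ι(φ(E))` — the hypothesis «`k ⊇ K*`» of Thm. 21.4 at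
  `(K, Φ) := (M, Ψ̃)`, `k := E`.  Proof: an automorphism of `ℂ` fixing `ι(φ(E))` is `ι ∘ h` on `L` with `h ∘ φ = φ`, and such
  `h` satisfy `h · S* = S*`, so it permutes `Ψ̃` and fixes the trace; elements of `ℂ` fixed by `Aut(ℂ/ι(φ(E)))` lie in
  `ι(φ(E))` (`Complex.exists_ringEquiv_fix_apply_ne`).

## References
* [Shimura1998] G. Shimura, *Abelian Varieties with Complex Multiplication and Modular Functions* (1998), §8.3 Prop. 28
  and the following paragraph, §18.5, §19.7, Prop. 19.10.
* [Streng2010] M. Streng, *Complex multiplication of abelian surfaces*, thesis (2010), Ch. I Lemma 7.2.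
* [Liu2021] Y. Liu, Camb. J. Math. 9 (2021), Def. 4.3 (2) (TeX l. 1919), §4.1 l. 1928, Def. 4.5 (1).
-/

set_option autoImplicit false

noncomputable section

open scoped Pointwise
open NumberField

namespace Literature.NumberTheory.ComplexMultiplication

open Literature.AlgebraicGeometry.Motives (CMType)

variable {E : Type} [Field E] [NumberField E]
  {L : Type} [Field L] [NumberField L] [IsCMField L] [IsGalois ℚ L]
  (Φ : CMType E) (φ : E →ₐ[ℚ] L) (ι : L →+* ℂ)
  {M : Type} [Field M] (e : reflexField ℚ L (algValuedIn ι Φ.1) →+* M) (τ₀ : M →+* ℂ)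
  (he : ∀ k, τ₀ (e k) = ι k)

/-! ## §1 Automorphisms of `ℂ` restricted to the Galois field `L` -/

/-- `g (g⁻¹ z) = z` in `Aut ℂ`. [folklore] -/
private theorem ringAut_apply_inv_apply (g : ℂ ≃+* ℂ) (z : ℂ) : g (g⁻¹ z) = z := by
  change (g * g⁻¹) z = z
  rw [mul_inv_cancel]
  rfl

/-- `g⁻¹ (g z) = z` in `Aut ℂ`. [folklore] -/
private theorem ringAut_inv_apply_apply (g : ℂ ≃+* ℂ) (z : ℂ) : g⁻¹ (g z) = z := by
  change (g⁻¹ * g) z = z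
  rw [inv_mul_cancel]
  rfl

omit [IsCMField L] [IsGalois ℚ L] in
/-- `h (h⁻¹ b) = b` in `Gal(L/ℚ)`. [folklore] -/
private theorem algEquiv_apply_inv_apply (h : L ≃ₐ[ℚ] L) (b : L) : h (h⁻¹ b) = b := by
  change (h * h⁻¹) b = b
  rw [mul_inv_cancel]
  rfl

omit [IsCMField L] in
/-- Every automorphism `g` of `ℂ` restricts along `ι` to an automorphism `h` of the Galois field `L`: `g ∘ ι = ι ∘ h`.
[folklore] -/
private theorem exists_algEquiv_comp_eq_ringEquiv_comp (g : ℂ ≃+* ℂ) :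
    ∃ h : L ≃ₐ[ℚ] L, ι.comp (h : L →+* L) = (g : ℂ →+* ℂ).comp ι := by
  obtain ⟨ψ, hψ⟩ := exists_algHom_comp_eq_of_normal (AlgHom.id ℚ L) ι ((g : ℂ →+* ℂ).comp ι)
  exact ⟨AlgEquiv.ofBijective ψ (Algebra.IsAlgebraic.algHom_bijective ψ), hψ⟩

omit [IsCMField L] [IsGalois ℚ L] in
/-- Every automorphism `h` of `L` extends along `ι` to an automorphism `g` of `ℂ`: `g ∘ ι = ι ∘ h` (`Aut ℂ` is transitive on
the embeddings of the countable field `L`). [folklore] -/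
private theorem exists_ringEquiv_comp_eq_comp_algEquiv (h : L ≃ₐ[ℚ] L) :
    ∃ g : ℂ ≃+* ℂ, (g : ℂ →+* ℂ).comp ι = ι.comp (h : L →+* L) := by
  haveI : Countable L := Countable.of_equiv _ (Module.finBasis ℚ L).equivFun.toEquiv.symm
  obtain ⟨g, hg⟩ := Literature.AlgebraicGeometry.Motives.ZarhinLie.exists_ringEquiv_complex_comp_eq ι
    (ι.comp (h : L →+* L))
  exact ⟨g, RingHom.ext fun a => hg a⟩

/-! ## §2 The reflex type ON `E` of the induced reflex type is `Φ` -/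

include he in
/-- The key equivalence, for `g ∈ Aut ℂ` restricting to `h ∈ Gal(L/ℚ)` (`g ∘ ι = ι ∘ h`): `g ∘ τ₀ ∈ Ψ̃ ↔ h⁻¹ ∈ S*(Φ_L, φ)`,
i.e. `↔ ι ∘ h⁻¹ ∘ φ ∈ Φ` («`S(Φ*, ι*) = S*(Φ, φ)`», `comp_smul_val_mem_reflexCMType_iff`). [cite: Shimura1998, §8.3 (paragraph after Prop. 28)] -/
theorem ringEquiv_smul_mem_inducedCMType_reflexCMType_iff (g : ℂ ≃+* ℂ) (h : L ≃ₐ[ℚ] L)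
    (hgh : ι.comp (h : L →+* L) = (g : ℂ →+* ℂ).comp ι) :
    g • τ₀ ∈ (inducedCMType e (reflexCMType ι Φ φ)).1 ↔ ι.comp ((h⁻¹ • φ : E →ₐ[ℚ] L) : E →+* L) ∈ Φ.1 := by
  rw [mem_inducedCMType_iff]
  have hcomp : (g • τ₀).comp e =
      ι.comp (((h • (reflexField ℚ L (algValuedIn ι Φ.1)).val : _ →ₐ[ℚ] L)) :
        reflexField ℚ L (algValuedIn ι Φ.1) →+* L) := by
    refine RingHom.ext fun k => ?_
    change g (τ₀ (e k)) = ι (h ((reflexField ℚ L (algValuedIn ι Φ.1)).val k))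
    rw [he k]
    exact (RingHom.congr_fun hgh ((reflexField ℚ L (algValuedIn ι Φ.1)).val k)).symm
  rw [hcomp, comp_smul_val_mem_reflexCMType_iff, mem_reflexLift, mem_algValuedIn_iff]

include he in
/-- **`reflexTypeOn Ψ̃ τ₀ (ι ∘ φ) = Φ`**: the reflex type ON `E` (seen from `τ₀`, along `ι ∘ φ`) of the CM type
`Ψ̃ = inducedCMType e (reflexCMType ι Φ φ)` of `M` induced from the reflex type of `Φ` is `Φ` itself — the duality
`(K*, Φ*)* ⊂ (K, Φ)` of [Shimura1998] §8.3 transported to the induced type on `M ⊇ K*`, in the form consumed by (19.10a)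
(`cmInfinityType`). [cite: Shimura1998, §8.3 Prop. 28 and the following paragraph; Prop. 19.10 (19.10a)]
[cite: Streng2010, Ch. I Lemma 7.2] -/
theorem reflexTypeOn_inducedCMType_reflexCMType :
    reflexTypeOn (inducedCMType e (reflexCMType ι Φ φ)).1 τ₀ (ι.comp (φ : E →+* L)) = Φ.1 := by
  ext σ'
  rw [mem_reflexTypeOn_iff]
  constructor
  · rintro ⟨g, hg, rfl⟩
    obtain ⟨h, hgh⟩ := exists_algEquiv_comp_eq_ringEquiv_comp ι g⁻¹
    have hmem := (ringEquiv_smul_mem_inducedCMType_reflexCMType_iff Φ φ ι e τ₀ he g⁻¹ h hgh).1 hg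
    have heq : g • ι.comp (φ : E →+* L) = ι.comp ((h⁻¹ • φ : E →ₐ[ℚ] L) : E →+* L) := by
      refine RingHom.ext fun a => ?_
      change g (ι (φ a)) = ι (h⁻¹ (φ a))
      have h1 := RingHom.congr_fun hgh (h⁻¹ (φ a))
      change ι (h (h⁻¹ (φ a))) = g⁻¹ (ι (h⁻¹ (φ a))) at h1
      rw [algEquiv_apply_inv_apply] at h1
      rw [h1, ringAut_apply_inv_apply]
    rw [heq]
    exact hmem
  · intro hσ'
    obtain ⟨χ, hχ⟩ := exists_algHom_comp_eq_of_normal φ ι σ'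
    obtain ⟨h, hh⟩ := exists_algEquiv_smul_eq φ χ
    obtain ⟨g, hg⟩ := exists_ringEquiv_comp_eq_comp_algEquiv ι h
    -- `ι ∘ h⁻¹ = g⁻¹ ∘ ι`
    have hgh : ι.comp ((h⁻¹ : L ≃ₐ[ℚ] L) : L →+* L) = ((g⁻¹ : ℂ ≃+* ℂ) : ℂ →+* ℂ).comp ι := by
      refine RingHom.ext fun b => ?_
      change ι (h⁻¹ b) = g⁻¹ (ι b)
      have h1 := RingHom.congr_fun hg (h⁻¹ b)
      change g (ι (h⁻¹ b)) = ι (h (h⁻¹ b)) at h1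
      rw [algEquiv_apply_inv_apply] at h1
      rw [← h1, ringAut_inv_apply_apply]
    have hmem : g⁻¹ • τ₀ ∈ (inducedCMType e (reflexCMType ι Φ φ)).1 := by
      refine (ringEquiv_smul_mem_inducedCMType_reflexCMType_iff Φ φ ι e τ₀ he g⁻¹ h⁻¹ hgh).2 ?_
      rw [inv_inv, hh, hχ]
      exact hσ'
    refine ⟨g, hmem, RingHom.ext fun a => ?_⟩
    change g (ι (φ a)) = σ' a
    rw [← hχ, ← hh]
    exact RingHom.congr_fun hg (φ a)

include he in
/-- **(19.10a) at the induced type**: the ∞-type `cmInfinityType Ψ̃ τ₀ (ι ∘ φ)` of the character `χ = χ_{τ₀}` of a structure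
of type `(M, Ψ̃)` over `E` is the type attached to the indicator of `Φ` — exponent `1` exactly at the embeddings of `Φ`.
[cite: Shimura1998, Prop. 19.10 (19.10a)] -/
theorem cmInfinityType_inducedCMType_reflexCMType :
    cmInfinityType (inducedCMType e (reflexCMType ι Φ φ)).1 τ₀ (ι.comp (φ : E →+* L)) =
      Literature.NumberTheory.GaloisRepresentations.HeckeCharacter.typeOfExponent
        (Φ.1.indicator fun _ => (1 : ℤ)) := by
  rw [cmInfinityType, reflexTypeOn_inducedCMType_reflexCMType Φ φ ι e τ₀ he]

/-! ## §3 «`K** ⊂ K`»: the reflex field of `(M, Ψ̃)` lies in `ι(φ(E))` -/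

/-- An automorphism `g` of `ℂ` fixing `ι(φ(E))` pointwise PERMUTES `Ψ̃`: `g ∘ θ ∈ Ψ̃` for `θ ∈ Ψ̃` (restricting `g` to
`h ∈ Gal(L/φ(E))`, `h · S* = S*`). [cite: Shimura1998, §8.3 (proof of Prop. 28: `HS = S`)] -/
theorem ringEquiv_smul_mem_inducedCMType_of_fix {g : ℂ ≃+* ℂ} (hfix : ∀ a : E, g (ι (φ a)) = ι (φ a))
    {θ : M →+* ℂ} (hθ : θ ∈ (inducedCMType e (reflexCMType ι Φ φ)).1) :
    g • θ ∈ (inducedCMType e (reflexCMType ι Φ φ)).1 := by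
  obtain ⟨h, hgh⟩ := exists_algEquiv_comp_eq_ringEquiv_comp ι g
  have hφ : h • φ = φ := by
    refine AlgHom.ext fun a => ι.injective ?_
    change ι (h (φ a)) = ι (φ a)
    rw [← hfix a]
    exact RingHom.congr_fun hgh (φ a)
  rw [mem_inducedCMType_iff] at hθ ⊢
  obtain ⟨ψ, hψ, hψθ⟩ := (mem_reflexCMType_iff ι Φ φ _).1 hθ
  obtain ⟨s, hs, rfl⟩ := (mem_reflexType_iff ℚ L _ φ ψ).1 hψ
  refine (mem_reflexCMType_iff ι Φ φ _).2 ⟨(h * s) • (reflexField ℚ L (algValuedIn ι Φ.1)).val, ?_, ?_⟩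
  · refine smul_val_mem_reflexType ℚ L ?_
    rw [mem_reflexLift, mul_inv_rev, mul_smul]
    have hφ' : h⁻¹ • φ = φ := by
      conv_lhs => rw [← hφ]
      rw [inv_smul_smul]
    rw [hφ']
    exact (mem_reflexLift _ _ _).1 hs
  · refine RingHom.ext fun k => ?_
    have h1 := RingHom.congr_fun hψθ k
    change ι (s ((reflexField ℚ L (algValuedIn ι Φ.1)).val k)) = θ (e k) at h1
    change ι ((h * s) ((reflexField ℚ L (algValuedIn ι Φ.1)).val k)) = g (θ (e k))
    rw [← h1, AlgEquiv.mul_apply]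
    exact RingHom.congr_fun hgh _

/-- **Every type trace of `Ψ̃` lies in `ι(φ(E))`**: `∑_{θ ∈ Ψ̃} θ(x) ∈ ι(φ(E))` for all `x ∈ M` — it is fixed by every
automorphism of `ℂ` fixing `ι(φ(E))` (which permutes `Ψ̃`), and `ι(φ(E))` is countable
(`Complex.exists_ringEquiv_fix_apply_ne`). [cite: Shimura1998, §8.3 Prop. 28 (`K*` as the field of type traces) and the following paragraph (`K** ⊂ K`)] -/
theorem cmTypeTrace_inducedCMType_reflexCMType_mem_range [NumberField M] (x : M) :
    cmTypeTrace (inducedCMType e (reflexCMType ι Φ φ)) x ∈ Set.range (ι.comp (φ : E →+* L)) := by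
  set Ψ := inducedCMType e (reflexCMType ι Φ φ) with hΨ
  set K₀ : Subfield ℂ := (ι.comp (φ : E →+* L)).fieldRange with hK₀
  have hK₀c : Cardinal.mk K₀ ≤ Cardinal.aleph0 := by
    haveI : Countable E := Countable.of_equiv _ (Module.finBasis ℚ E).equivFun.toEquiv.symm
    have hc : (Set.range (ι.comp (φ : E →+* L))).Countable := Set.countable_range _
    have hK₀' : (K₀ : Set ℂ) = Set.range (ι.comp (φ : E →+* L)) := RingHom.coe_fieldRange _
    rw [← hK₀', ← Cardinal.le_aleph0_iff_set_countable] at hc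
    exact hc
  suffices hmem : cmTypeTrace Ψ x ∈ K₀ by
    obtain ⟨a, ha⟩ := RingHom.mem_fieldRange.1 hmem
    exact ⟨a, ha⟩
  by_contra hnot
  obtain ⟨g, hgfix, hgne⟩ := Literature.FieldTheory.AlgClosed.Complex.exists_ringEquiv_fix_apply_ne K₀ hK₀c hnot
  apply hgne
  have hfix : ∀ a : E, g (ι (φ a)) = ι (φ a) := fun a =>
    hgfix _ (RingHom.mem_fieldRange.2 ⟨a, rfl⟩)
  -- `g` permutes the finite set `Ψ̃`
  have hperm : ∀ θ ∈ (Set.toFinite Ψ.1).toFinset, g • θ ∈ (Set.toFinite Ψ.1).toFinset := fun θ hθ => by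
    rw [Set.Finite.mem_toFinset] at hθ ⊢
    exact ringEquiv_smul_mem_inducedCMType_of_fix Φ φ ι e hfix hθ
  rw [cmTypeTrace_apply, map_sum]
  refine Finset.sum_bij' (fun θ _ => g • θ) (fun θ _ => g⁻¹ • θ) hperm ?_ ?_ ?_ ?_
  · intro θ hθ
    rw [Set.Finite.mem_toFinset] at hθ ⊢
    have hfix' : ∀ a : E, g⁻¹ (ι (φ a)) = ι (φ a) := fun a => by
      conv_lhs => rw [← hfix a]
      exact ringAut_inv_apply_apply g _
    exact ringEquiv_smul_mem_inducedCMType_of_fix Φ φ ι e hfix' hθ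
  · intro θ _; rw [inv_smul_smul]
  · intro θ _; rw [smul_inv_smul]
  · intro θ _; rfl

/-- **«`k ⊇ K*`» for Thm. 21.4 at the induced type**: the reflex field `ℚ(tr_Ψ̃(M)) ⊆ ℂ` of `(M, Ψ̃)` (tree `traceField`) is
contained in `ι(φ(E))`. [cite: Shimura1998, §8.3 (paragraph after Prop. 28: `K** ⊂ K`) and §21.4 Thm. 21.4] -/
theorem traceField_inducedCMType_reflexCMType_subset_range [NumberField M] :
    ((traceField (inducedCMType e (reflexCMType ι Φ φ)) : IntermediateField ℚ ℂ) : Set ℂ) ⊆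
      Set.range (ι.comp (φ : E →+* L)) := by
  have hle : traceField (inducedCMType e (reflexCMType ι Φ φ)) ≤ (ι.comp (φ : E →+* L)).toRatAlgHom.fieldRange := by
    rw [traceField, IntermediateField.adjoin_le_iff]
    rintro _ ⟨x, rfl⟩
    obtain ⟨a, ha⟩ := cmTypeTrace_inducedCMType_reflexCMType_mem_range Φ φ ι e x
    exact ⟨a, ha⟩
  intro z hz
  obtain ⟨a, ha⟩ := AlgHom.mem_fieldRange.1 (hle hz)
  exact ⟨a, ha⟩

end Literature.NumberTheory.ComplexMultiplication

end
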